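import Literature.Analysis.FluidPDE.SereginZajaczkowski2007Lemma23
import Literature.Analysis.FluidPDE.SereginEpsilonRegularityGradient
import HarnessLib

/-!
# Seregin–Zajaczkowski 2007, Lemma 2.3 and Proposition 4.1 from the named facts of the tree

Proofs-only assembly (no definitions) closing the reduction of
`SereginZajaczkowski2007.L6EpsilonRegularity` (G. Seregin, W. Zajaczkowski, SIAM J. Math. Anal. 39
(2007) 669–685 = arXiv:math/0702720, Lemma 2.3) carried out in
`SereginZajaczkowski2007Lemma23Tools.lean` / `SereginZajaczkowski2007Lemma23.lean`: there the gradient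
half of "the ε-regularity theory [LS], [ESS4], [S8]" enters as an explicit hypothesis `H2`; here it
is fed by the named fact `seregin2014_lemma61_gradient` (`SereginEpsilonRegularityGradient.lean`,
Seregin 2014 Ch. 6 Lemma 6.1, `k = 2`), giving

* `l6EpsilonRegularity_of : seregin_sverak_pressure_decay → lemarieRieusset_epsilon_regularity →
  seregin2014_lemma61_gradient → L6EpsilonRegularity` (Lemma 2.3 from the three inputs of its
  printed proof: (2.2) [S2], and the ε-regularity theory for the velocity and for the gradient);
* `offAxisSupBound_of_facts : OffAxisL6Bound → seregin_sverak_pressure_decay →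
  lemarieRieusset_epsilon_regularity → seregin2014_lemma61_gradient → OffAxisSupBound`
  (Prop. 4.1 "Applying Corollary 4.4 and Lemma 2.3", through the accepted `offAxisSupBound_of`).

So the trust base of Lemma 2.3 in the tree is now `{seregin_sverak_pressure_decay,
lemarieRieusset_epsilon_regularity, seregin2014_lemma61_gradient}` and that of Prop. 4.1 adds
Cor. 4.4 (`OffAxisL6Bound`, the energy method of §4).

## References

* G. Seregin, W. Zajaczkowski, SIAM J. Math. Anal. 39 (2007), arXiv:math/0702720: Lemma 2.3 and
  its proof (p. 3), Prop. 4.1 and its proof (§4, p. 7). [`SereginZajaczkowski2007`]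
* G. Seregin, *Lecture Notes on Regularity Theory for the Navier–Stokes Equations* (2014), Ch. 6,
  Lemma 6.1 (p. 90). [`Seregin2014`]
-/

noncomputable section

namespace Literature.Analysis.FluidPDE

namespace SereginZajaczkowski2007

/-- **Seregin–Zajaczkowski 2007, Lemma 2.3, from the named facts of its printed proof**: the decay
estimate for the pressure (2.2) (`seregin_sverak_pressure_decay`, "[S2]"), the one-scale
ε-regularity criterion for the velocity (`lemarieRieusset_epsilon_regularity`) and the
ε-regularity bound for the gradient (`seregin2014_lemma61_gradient`, Seregin 2014 Lemma 6.1
`k = 2` = [ESS4] Lemma 2.2) — "according to the so-called ε-regularity theory, see, for example,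
[LS], [ESS4], and [S8], the latter implies two bounds: `|v(z₀)| ≤ c/r₀` and `|∇v(z₀)| ≤ c/r₀²`"
(arXiv p. 3). The proof is `l6EpsilonRegularity_of_inputs` with `H2` supplied by
`seregin2014_lemma61_gradient.ae_bound`. [cite: SereginZajaczkowski2007, Lemma 2.3 and its proof (arXiv pp. 3–4)] -/
theorem l6EpsilonRegularity_of (h22 : seregin_sverak_pressure_decay)
    (hLR : lemarieRieusset_epsilon_regularity) (h61 : seregin2014_lemma61_gradient) :
    L6EpsilonRegularity := by
  obtain ⟨ε₂, c₀₂, hε₂, hc₀₂, H2⟩ := h61.ae_bound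
  exact l6EpsilonRegularity_of_inputs h22 hLR hε₂ hc₀₂ H2

/-- **Seregin–Zajaczkowski 2007, Proposition 4.1, from Corollary 4.4 and the inputs of Lemma 2.3**
("Applying Corollary 4.4 and Lemma 2.3, we end up with the proof of Proposition 4.1", §4, p. 7):
the accepted reduction `offAxisSupBound_of : OffAxisL6Bound → L6EpsilonRegularity → OffAxisSupBound`
composed with `l6EpsilonRegularity_of`. [cite: SereginZajaczkowski2007, proof of Prop. 4.1 (§4, last paragraph, arXiv p. 7)] -/
theorem offAxisSupBound_of_facts (h44 : OffAxisL6Bound) (h22 : seregin_sverak_pressure_decay)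
    (hLR : lemarieRieusset_epsilon_regularity) (h61 : seregin2014_lemma61_gradient) :
    OffAxisSupBound :=
  offAxisSupBound_of h44 (l6EpsilonRegularity_of h22 hLR h61)

end SereginZajaczkowski2007

end Literature.Analysis.FluidPDE

end
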